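import Summits.BirchSwinnertonDyer.BirchSwinnertonDyer.Theorems.QuadraticBranchSignedControlPlusEtaNonsurjConjADoorMinusRecords
import Summits.BirchSwinnertonDyer.BirchSwinnertonDyer.Theorems.QuadraticBranchSignedControlPlusEtaNonsurjConjADoorEigenRecords
import HarnessLib

/-!
# Route `QuadraticBranchSignedControl` (rung K8, cell `bsd-potss`), residual crux `PlusEtaMainConjectureNonsurj`
# (stmt-BirchSwinnertonDyer-19606): UNCONGRUENT RECORDS — (C1⁺_η) at `p = 5` BY NAME on five more members of the UNCONGRUENT family u5a
# (the domain of v7's hardest stub `stub_etaMC_nonCM_uncongruent`), three through door L6⁻ and two through door L2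
# (seat `bsd-potss-k8eta-c2` g21; kit j326613 = E5-FAM-u5a, 104 twists, 52 cores, 3 h 20 min, GRH)

WHAT. The family u5a = the `5`-partners `W_D` of the quadratic twists `A^{(D)}` of `A = [1,−1,1,−4010,98676]` (the `t = 4/5` point of Zywina's
`X_ns⁺(5)` family; non-CM, mod-`5` image `C_ns⁺(5)`, NOT `5`-congruent to any CM row — k8eta-c2 g19 p666083), `|D| ≤ 337` fundamental, 104 members.
Kit j326613 (engine e5.gp 2e115a13…, `bnfinit` cap 6000 s per member) resolved `h(ℚ(P))` on 22 members (all `|D| ≤ 89` except 73, 76, 79) and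
`h(ℚ(x(P))) = 15` on ALL 104 (the degree-12 field `ℚ(x(P))` does not depend on `D`): doors PASS-L6⁻ 12 (`v₅ h(ℚ(P)) = 1 = v₅ 15`; `d₂ = d₃ = 0` on
12/12 as pre-registered P-γ), PASS-L2 3 (`D = −52, −67, −71`: `2` not an eigenvalue), PASS only by `S`-classes 4 (`D = 53, −68, −83, 89`; no kernel
door yet), eig-2 open 3 (`D = 29, −31, 41`); unresolved 82. Prime-`L` rank-one members (`ε = −1`, PARI plus-`η` `(λ, μ) = (1, 0)`, `r_an(W_D) = 1` by
PARI `ellanalyticrank` / g19 etanc) with a KERNEL door: `D = −4` (door L6⁻, record p703871), **`D = −23, 37, −47` (door L6⁻: `h(ℚ(P)) = 30, 30, 60`)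
and `D = −67, −71` (door L2: `h(ℚ(P)) = 600, 38400`, eigen dimensions `(d₁,d₂,d₃,d₄) = (0,0,1,1)`)** — this file instantiates the five new ones:
`etaMC_r1_u5a_{m23,37,m47}_5_of_relClassNumber` (instances of p703871's `EtaConjADoorMinusRecords.etaMC_r1_of_relClassNumber`) and
`etaMC_r1_u5a_{m67,m71}_5_of_eigenHom` (instances of p708181's `EtaConjADoorEigenRecords.etaMC_r1_of_eigenHom`). With p703871 the uncongruent
class now has SIX rows carried to (C1⁺_η) by name (g20: 0). Not instantiated: `D = 53, 89` (prime-`L` rank one, but PASS only by `S`-classes),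
`D = −31` (prime-`L` rank one, eig-2 open: Hecke candidate), `D = −59` (L6⁻ PASS, `λ⁺ = 3`: integral Kato inclusion only), `D = 8, 13, 17, 61`
(L6⁻ PASS, `λ⁺ = 0`, `r_an = 0`, non-CM rank-0 shape: needs `MissingLowerBoundAt`).

HONEST FRAMING (cell `bsd-potss`; FULL-BSD rank ≤ 1 programme, HUMAN RULING D-0036/D-0074): per-row RECORDS, CONDITIONAL on the displayed named
facts (`h22 h41 h6273 hGZK`) and per-row inputs (`r_an(W) = 1`, the tower clause, `(L_5⁺(V,η,X)) = (X)`, the class-group datum); the class numbers /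
eigen dimensions / analytic ranks are GRH resp. numerical values (evidence, not facts); no stub of 19606 is proved by name; the crux stays OPEN;
nothing is booked; `BSD(W,5)` is claimed for no pair. `--supports stmt-BirchSwinnertonDyer-19606`.

References: [Kobayashi2003] §4 (p. 8), Thm. 4.1; [CoatesSujatha2005] §3 (A), Thm. 3.4; [GrossZagier1986] Thm. (7.3); [Kolyvagin1990] Thm. A;
[Zywina2015] Thm. 1.4 (the `X_ns⁺(5)` family).
-/

set_option autoImplicit false
set_option linter.dupNamespace false
noncomputable section

open scoped Classical nonZeroDivisors

open CongruenceSubgroup NumberField Field WeierstrassCurve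
open Literature.NumberTheory.EllipticCurves Literature.NumberTheory.EllipticCurves.ModularForms
  Literature.NumberTheory.EllipticCurves.Rank1Residual Literature.NumberTheory.EllipticCurves.Rank1Residual.Typed
  Literature.NumberTheory.GaloisRepresentations Literature.NumberTheory.GaloisCohomology Literature.NumberTheory.NumberFields
  Literature.NumberTheory.EllipticCurves.GreenbergVatsal2000 ZpExtension
open Summit.BirchSwinnertonDyer.Rank1Residual Summit.BirchSwinnertonDyer.Rank1Residual.Additive
open Summit.BirchSwinnertonDyer.Rank1Residual.X11b (isElliptic_of_discOf_ne_zero)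
open Summit.BirchSwinnertonDyer.BirchSwinnertonDyer.Theorems
open Summit.BirchSwinnertonDyer.BirchSwinnertonDyer.Theorems.EtaConjADoorMinusRecords (etaMC_r1_of_relClassNumber)
open Summit.BirchSwinnertonDyer.BirchSwinnertonDyer.Theorems.EtaConjADoorEigenRecords (etaMC_r1_of_eigenHom)

namespace Summit.BirchSwinnertonDyer.BirchSwinnertonDyer.Theorems.EtaConjADoorUncongruentRecords

/-- The `5`-partner of u5a:-23, `W = [1, -1, 0, -53028117, -148536450084]` (non-CM, `N_W = 577390275`; `j(W) = j(A)`, `A = [1,−1,1,−4010,98676]` the `t = 4/5` member of Zywina's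
`X_ns⁺(5)` family, twisted by `D = -23`): `Δ ≠ 0` (kernel). [cite: Zywina2015, Thm. 1.4] -/
theorem isElliptic_u5a_m23 : (⟨1, (-1), 0, (-53028117), (-148536450084)⟩ : WeierstrassCurve ℚ).IsElliptic :=
  isElliptic_of_discOf_ne_zero 1 (-1) 0 (-53028117) (-148536450084) (by decide +kernel)

/-- **(C1⁺_η) at `p = 5` for every good `a_5 = 0` model `V` of the `5`-twist of the UNCONGRUENT partner u5a:-23** (`W = [1, -1, 0, -53028117, -148536450084]`, non-CM,
`N_W = 577390275`; kit j326613 (2165 s, GRH): `ε(W) = −1`, PARI plus-`η` `(λ, μ) = (1, 0)`, `r_an(W) = 1` (`ellanalyticrank`); `h(ℚ(P)) = 30` (`[30]`), `h(ℚ(x(P))) = 15`: `v₅ = 1 ≤ 1` — the plain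
class-number door is void, door L6⁻ passes) from the ROW ALONE — named facts `h22 h41 h6273 hGZK`; displayed `r_an(W) = 1`, the tower clause,
`(L_5⁺(V,η,X)) = (X)`, the relative class-number datum. A row of v7's `stub_etaMC_nonCM_uncongruent` (no CM curve is `5`-congruent to it, p666083).
Instance of `etaMC_r1_of_relClassNumber` (p703871). CONDITIONAL; nothing booked. [cite: Kobayashi2003, §4 (p. 8)] [cite: Zywina2015, Thm. 1.4] -/
theorem etaMC_r1_u5a_m23_5_of_relClassNumber
    (h22 : Kobayashi2003.thm22_etaSignedSelmerDual_finite_torsion)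
    (h41 : Kobayashi2003.thm41_plusEtaCharIdeal_dvd)
    (h6273 : Kobayashi2003.thm62_63_73_etaColemanPoitouTate)
    (hGZK : rank_eq_analyticRank_of_analyticRank_le_one) [Fact (5 : ℕ).Prime]
    (W : WeierstrassCurve ℚ) (hW : W = (⟨1, (-1), 0, (-53028117), (-148536450084)⟩ : WeierstrassCurve ℚ)) (hr : W.analyticRank = 1)
    (V : WeierstrassCurve ℚ) [V.IsElliptic] [V.IsGloballyMinimal] (C : VariableChange ℚ)
    (hC : C • W.quadraticTwist 5 = V)
    (hgood : V.HasGoodReductionAtPrime 5) (hap : V.frobeniusTrace 5 = 0)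
    (hns : ¬ ∀ m : ℕ, V.HasSurjectiveModNGaloisRep (5 ^ m : ℕ))
    (hX : ∀ {N : ℕ} [NeZero N] {f : CuspForm (Gamma0 N) 2}, IsNewformOf V f →
      ∀ (ϖ : ℚ), (if Even (5 / 2) then (ϖ : ℝ) * V.realPeriodRat = plusPeriod f
          else (ϖ : ℝ) * V.imaginaryPeriodRat = minusPeriod f) →
      ∀ (Lη : IwasawaAlgebra 5), IsQuadraticBranchPlusLFunction f 5 ϖ Lη →
        Ideal.span {Lη} = Ideal.span {(PowerSeries.X : IwasawaAlgebra 5)})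
    (hP : haveI : W.IsElliptic := hW ▸ isElliptic_u5a_m23
      haveI : NeZero (5 : ℕ) := ⟨by norm_num⟩
      haveI : NumberField (W.divisionField 5) := NumberField.mk
      ∃ P : geomTorsion W ((5 : ℕ) : ℤ), P ≠ 0 ∧ ∀ τ : absoluteGaloisGroup ℚ, τ • P = -P →
        ∀ K : IntermediateField ℚ (W.divisionField 5),
          K = IntermediateField.fixedField
            ((MulAction.stabilizer (absoluteGaloisGroup ℚ) P).map (absRestrictNormalHom (W.divisionField 5))) →
        ∀ σ : K ≃ₐ[ℚ] K,
          (∀ x : K, absRestrictNormalHom (W.divisionField 5) τ (x : W.divisionField 5) =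
            ((σ x : K) : W.divisionField 5)) →
          padicValNat 5 (NumberField.classNumber K) ≤
            padicValNat 5 (NumberField.classNumber (IntermediateField.fixedField (Subgroup.zpowers σ)))) :
    QuadraticBranchPlusEtaMainConjectureAt V 5 := by
  subst hW
  haveI : (⟨1, (-1), 0, (-53028117), (-148536450084)⟩ : WeierstrassCurve ℚ).IsElliptic := isElliptic_u5a_m23
  haveI : NeZero (5 : ℕ) := ⟨by norm_num⟩
  exact etaMC_r1_of_relClassNumber h22 h41 h6273 hGZK 5 (le_refl 5) _ hr V C
    (by rw [show ((-1 : ℚ) ^ ((5 : ℕ) / 2) * ((5 : ℕ) : ℚ)) = 5 by norm_num]; exact hC) hgood hap hns hX hP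

/-- The `5`-partner of u5a:37, `W = [1, -1, 1, -137231555, 618468458822]` (non-CM, `N_W = 1494229275`; `j(W) = j(A)`, `A = [1,−1,1,−4010,98676]` the `t = 4/5` member of Zywina's
`X_ns⁺(5)` family, twisted by `D = 37`): `Δ ≠ 0` (kernel). [cite: Zywina2015, Thm. 1.4] -/
theorem isElliptic_u5a_37 : (⟨1, (-1), 1, (-137231555), 618468458822⟩ : WeierstrassCurve ℚ).IsElliptic :=
  isElliptic_of_discOf_ne_zero 1 (-1) 1 (-137231555) 618468458822 (by decide +kernel)

/-- **(C1⁺_η) at `p = 5` for every good `a_5 = 0` model `V` of the `5`-twist of the UNCONGRUENT partner u5a:37** (`W = [1, -1, 1, -137231555, 618468458822]`, non-CM,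
`N_W = 1494229275`; kit j326613 (255 s, GRH): `ε(W) = −1`, PARI plus-`η` `(λ, μ) = (1, 0)`, `r_an(W) = 1` (`ellanalyticrank`); `h(ℚ(P)) = 30` (`[30]`), `h(ℚ(x(P))) = 15`: `v₅ = 1 ≤ 1` — the plain
class-number door is void, door L6⁻ passes) from the ROW ALONE — named facts `h22 h41 h6273 hGZK`; displayed `r_an(W) = 1`, the tower clause,
`(L_5⁺(V,η,X)) = (X)`, the relative class-number datum. A row of v7's `stub_etaMC_nonCM_uncongruent` (no CM curve is `5`-congruent to it, p666083).
Instance of `etaMC_r1_of_relClassNumber` (p703871). CONDITIONAL; nothing booked. [cite: Kobayashi2003, §4 (p. 8)] [cite: Zywina2015, Thm. 1.4] -/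
theorem etaMC_r1_u5a_37_5_of_relClassNumber
    (h22 : Kobayashi2003.thm22_etaSignedSelmerDual_finite_torsion)
    (h41 : Kobayashi2003.thm41_plusEtaCharIdeal_dvd)
    (h6273 : Kobayashi2003.thm62_63_73_etaColemanPoitouTate)
    (hGZK : rank_eq_analyticRank_of_analyticRank_le_one) [Fact (5 : ℕ).Prime]
    (W : WeierstrassCurve ℚ) (hW : W = (⟨1, (-1), 1, (-137231555), 618468458822⟩ : WeierstrassCurve ℚ)) (hr : W.analyticRank = 1)
    (V : WeierstrassCurve ℚ) [V.IsElliptic] [V.IsGloballyMinimal] (C : VariableChange ℚ)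
    (hC : C • W.quadraticTwist 5 = V)
    (hgood : V.HasGoodReductionAtPrime 5) (hap : V.frobeniusTrace 5 = 0)
    (hns : ¬ ∀ m : ℕ, V.HasSurjectiveModNGaloisRep (5 ^ m : ℕ))
    (hX : ∀ {N : ℕ} [NeZero N] {f : CuspForm (Gamma0 N) 2}, IsNewformOf V f →
      ∀ (ϖ : ℚ), (if Even (5 / 2) then (ϖ : ℝ) * V.realPeriodRat = plusPeriod f
          else (ϖ : ℝ) * V.imaginaryPeriodRat = minusPeriod f) →
      ∀ (Lη : IwasawaAlgebra 5), IsQuadraticBranchPlusLFunction f 5 ϖ Lη →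
        Ideal.span {Lη} = Ideal.span {(PowerSeries.X : IwasawaAlgebra 5)})
    (hP : haveI : W.IsElliptic := hW ▸ isElliptic_u5a_37
      haveI : NeZero (5 : ℕ) := ⟨by norm_num⟩
      haveI : NumberField (W.divisionField 5) := NumberField.mk
      ∃ P : geomTorsion W ((5 : ℕ) : ℤ), P ≠ 0 ∧ ∀ τ : absoluteGaloisGroup ℚ, τ • P = -P →
        ∀ K : IntermediateField ℚ (W.divisionField 5),
          K = IntermediateField.fixedField
            ((MulAction.stabilizer (absoluteGaloisGroup ℚ) P).map (absRestrictNormalHom (W.divisionField 5))) →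
        ∀ σ : K ≃ₐ[ℚ] K,
          (∀ x : K, absRestrictNormalHom (W.divisionField 5) τ (x : W.divisionField 5) =
            ((σ x : K) : W.divisionField 5)) →
          padicValNat 5 (NumberField.classNumber K) ≤
            padicValNat 5 (NumberField.classNumber (IntermediateField.fixedField (Subgroup.zpowers σ)))) :
    QuadraticBranchPlusEtaMainConjectureAt V 5 := by
  subst hW
  haveI : (⟨1, (-1), 1, (-137231555), 618468458822⟩ : WeierstrassCurve ℚ).IsElliptic := isElliptic_u5a_37
  haveI : NeZero (5 : ℕ) := ⟨by norm_num⟩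
  exact etaMC_r1_of_relClassNumber h22 h41 h6273 hGZK 5 (le_refl 5) _ hr V C
    (by rw [show ((-1 : ℚ) ^ ((5 : ℕ) / 2) * ((5 : ℕ) : ℚ)) = 5 by norm_num]; exact hC) hgood hap hns hX hP

/-- The `5`-partner of u5a:-47, `W = [1, -1, 0, -221434992, -1267543576209]` (non-CM, `N_W = 2411068275`; `j(W) = j(A)`, `A = [1,−1,1,−4010,98676]` the `t = 4/5` member of Zywina's
`X_ns⁺(5)` family, twisted by `D = -47`): `Δ ≠ 0` (kernel). [cite: Zywina2015, Thm. 1.4] -/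
theorem isElliptic_u5a_m47 : (⟨1, (-1), 0, (-221434992), (-1267543576209)⟩ : WeierstrassCurve ℚ).IsElliptic :=
  isElliptic_of_discOf_ne_zero 1 (-1) 0 (-221434992) (-1267543576209) (by decide +kernel)

/-- **(C1⁺_η) at `p = 5` for every good `a_5 = 0` model `V` of the `5`-twist of the UNCONGRUENT partner u5a:-47** (`W = [1, -1, 0, -221434992, -1267543576209]`, non-CM,
`N_W = 2411068275`; kit j326613 (1919 s, GRH): `ε(W) = −1`, PARI plus-`η` `(λ, μ) = (1, 0)`, `r_an(W) = 1` (`ellanalyticrank`); `h(ℚ(P)) = 60` (`[30,2]`), `h(ℚ(x(P))) = 15`: `v₅ = 1 ≤ 1` — the plain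
class-number door is void, door L6⁻ passes) from the ROW ALONE — named facts `h22 h41 h6273 hGZK`; displayed `r_an(W) = 1`, the tower clause,
`(L_5⁺(V,η,X)) = (X)`, the relative class-number datum. A row of v7's `stub_etaMC_nonCM_uncongruent` (no CM curve is `5`-congruent to it, p666083).
Instance of `etaMC_r1_of_relClassNumber` (p703871). CONDITIONAL; nothing booked. [cite: Kobayashi2003, §4 (p. 8)] [cite: Zywina2015, Thm. 1.4] -/
theorem etaMC_r1_u5a_m47_5_of_relClassNumber
    (h22 : Kobayashi2003.thm22_etaSignedSelmerDual_finite_torsion)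
    (h41 : Kobayashi2003.thm41_plusEtaCharIdeal_dvd)
    (h6273 : Kobayashi2003.thm62_63_73_etaColemanPoitouTate)
    (hGZK : rank_eq_analyticRank_of_analyticRank_le_one) [Fact (5 : ℕ).Prime]
    (W : WeierstrassCurve ℚ) (hW : W = (⟨1, (-1), 0, (-221434992), (-1267543576209)⟩ : WeierstrassCurve ℚ)) (hr : W.analyticRank = 1)
    (V : WeierstrassCurve ℚ) [V.IsElliptic] [V.IsGloballyMinimal] (C : VariableChange ℚ)
    (hC : C • W.quadraticTwist 5 = V)
    (hgood : V.HasGoodReductionAtPrime 5) (hap : V.frobeniusTrace 5 = 0)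
    (hns : ¬ ∀ m : ℕ, V.HasSurjectiveModNGaloisRep (5 ^ m : ℕ))
    (hX : ∀ {N : ℕ} [NeZero N] {f : CuspForm (Gamma0 N) 2}, IsNewformOf V f →
      ∀ (ϖ : ℚ), (if Even (5 / 2) then (ϖ : ℝ) * V.realPeriodRat = plusPeriod f
          else (ϖ : ℝ) * V.imaginaryPeriodRat = minusPeriod f) →
      ∀ (Lη : IwasawaAlgebra 5), IsQuadraticBranchPlusLFunction f 5 ϖ Lη →
        Ideal.span {Lη} = Ideal.span {(PowerSeries.X : IwasawaAlgebra 5)})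
    (hP : haveI : W.IsElliptic := hW ▸ isElliptic_u5a_m47
      haveI : NeZero (5 : ℕ) := ⟨by norm_num⟩
      haveI : NumberField (W.divisionField 5) := NumberField.mk
      ∃ P : geomTorsion W ((5 : ℕ) : ℤ), P ≠ 0 ∧ ∀ τ : absoluteGaloisGroup ℚ, τ • P = -P →
        ∀ K : IntermediateField ℚ (W.divisionField 5),
          K = IntermediateField.fixedField
            ((MulAction.stabilizer (absoluteGaloisGroup ℚ) P).map (absRestrictNormalHom (W.divisionField 5))) →
        ∀ σ : K ≃ₐ[ℚ] K,
          (∀ x : K, absRestrictNormalHom (W.divisionField 5) τ (x : W.divisionField 5) =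
            ((σ x : K) : W.divisionField 5)) →
          padicValNat 5 (NumberField.classNumber K) ≤
            padicValNat 5 (NumberField.classNumber (IntermediateField.fixedField (Subgroup.zpowers σ)))) :
    QuadraticBranchPlusEtaMainConjectureAt V 5 := by
  subst hW
  haveI : (⟨1, (-1), 0, (-221434992), (-1267543576209)⟩ : WeierstrassCurve ℚ).IsElliptic := isElliptic_u5a_m47
  haveI : NeZero (5 : ℕ) := ⟨by norm_num⟩
  exact etaMC_r1_of_relClassNumber h22 h41 h6273 hGZK 5 (le_refl 5) _ hr V C
    (by rw [show ((-1 : ℚ) ^ ((5 : ℕ) / 2) * ((5 : ℕ) : ℚ)) = 5 by norm_num]; exact hC) hgood hap hns hX hP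

/-- The `5`-partner of u5a:-67, `W = [1, -1, 1, -449987180, -3671972286678]` (non-CM, `N_W = 4899631275`; `j(W) = j(A)`, `A = [1,−1,1,−4010,98676]` the `t = 4/5` member of Zywina's
`X_ns⁺(5)` family, twisted by `D = -67`): `Δ ≠ 0` (kernel). [cite: Zywina2015, Thm. 1.4] -/
theorem isElliptic_u5a_m67 : (⟨1, (-1), 1, (-449987180), (-3671972286678)⟩ : WeierstrassCurve ℚ).IsElliptic :=
  isElliptic_of_discOf_ne_zero 1 (-1) 1 (-449987180) (-3671972286678) (by decide +kernel)

/-- **(C1⁺_η) at `p = 5` for every good `a_5 = 0` model `V` of the `5`-twist of the UNCONGRUENT partner u5a:-67** (`W = [1, -1, 1, -449987180, -3671972286678]`, non-CM,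
`N_W = 4899631275`; kit j326613 (5709 s, GRH): `ε(W) = −1`, PARI plus-`η` `(λ, μ) = (1, 0)`, `r_an(W) = 1` (`ellanalyticrank`); `h(ℚ(P)) = 600` (`[30,10,2]`, `v₅ = 2 > 1`: door L6⁻ void), eigen dimensions `(d₁,d₂,d₃,d₄) = (0,0,1,1)`: `2` is not an eigenvalue of `σ₂` — the
plain class-number door and door L6⁻ are void, door L2 passes) from the ROW ALONE — named facts `h22 h41 h6273 hGZK`; displayed `r_an(W) = 1`, the
tower clause, `(L_5⁺(V,η,X)) = (X)`, the plain eigen datum. A row of v7's `stub_etaMC_nonCM_uncongruent` (p666083). Instance of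
`etaMC_r1_of_eigenHom` (p708181). CONDITIONAL; nothing booked. [cite: Kobayashi2003, §4 (p. 8)] [cite: CoatesSujatha2005, §3 Thm. 3.4] [cite: Zywina2015, Thm. 1.4] -/
theorem etaMC_r1_u5a_m67_5_of_eigenHom
    (h22 : Kobayashi2003.thm22_etaSignedSelmerDual_finite_torsion)
    (h41 : Kobayashi2003.thm41_plusEtaCharIdeal_dvd)
    (h6273 : Kobayashi2003.thm62_63_73_etaColemanPoitouTate)
    (hGZK : rank_eq_analyticRank_of_analyticRank_le_one) [Fact (5 : ℕ).Prime]
    (W : WeierstrassCurve ℚ) (hW : W = (⟨1, (-1), 1, (-449987180), (-3671972286678)⟩ : WeierstrassCurve ℚ)) (hr : W.analyticRank = 1)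
    (V : WeierstrassCurve ℚ) [V.IsElliptic] [V.IsGloballyMinimal] (C : VariableChange ℚ)
    (hC : C • W.quadraticTwist 5 = V)
    (hgood : V.HasGoodReductionAtPrime 5) (hap : V.frobeniusTrace 5 = 0)
    (hns : ¬ ∀ m : ℕ, V.HasSurjectiveModNGaloisRep (5 ^ m : ℕ))
    (hX : ∀ {N : ℕ} [NeZero N] {f : CuspForm (Gamma0 N) 2}, IsNewformOf V f →
      ∀ (ϖ : ℚ), (if Even (5 / 2) then (ϖ : ℝ) * V.realPeriodRat = plusPeriod f
          else (ϖ : ℝ) * V.imaginaryPeriodRat = minusPeriod f) →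
      ∀ (Lη : IwasawaAlgebra 5), IsQuadraticBranchPlusLFunction f 5 ϖ Lη →
        Ideal.span {Lη} = Ideal.span {(PowerSeries.X : IwasawaAlgebra 5)})
    (hP : haveI : W.IsElliptic := hW ▸ isElliptic_u5a_m67
      haveI : NeZero (5 : ℕ) := ⟨by norm_num⟩
      haveI : NumberField (W.divisionField 5) := NumberField.mk
      ∃ P : geomTorsion W ((5 : ℕ) : ℤ), P ≠ 0 ∧
        ∀ K : IntermediateField ℚ (W.divisionField 5),
          K = IntermediateField.fixedField
            ((MulAction.stabilizer (absoluteGaloisGroup ℚ) P).map (absRestrictNormalHom (W.divisionField 5))) →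
        ∀ μ : Additive (ClassGroup (𝓞 K)) →+ ZMod 5,
          (∀ (τ : absoluteGaloisGroup ℚ) (σ : K ≃ₐ[ℚ] K) (a : ℕ),
              (∀ x : K, absRestrictNormalHom (W.divisionField 5) τ (x : W.divisionField 5) =
                ((σ x : K) : W.divisionField 5)) → τ • P = a • P →
              ∀ (I J : (Ideal (𝓞 K))⁰),
                (J : Ideal (𝓞 K)) = (I : Ideal (𝓞 K)).map (AmbiguousClass.intAut σ : 𝓞 K →+* 𝓞 K) →
                μ (Additive.ofMul (ClassGroup.mk0 J)) = a • μ (Additive.ofMul (ClassGroup.mk0 I))) →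
          μ = 0) :
    QuadraticBranchPlusEtaMainConjectureAt V 5 := by
  subst hW
  haveI : (⟨1, (-1), 1, (-449987180), (-3671972286678)⟩ : WeierstrassCurve ℚ).IsElliptic := isElliptic_u5a_m67
  haveI : NeZero (5 : ℕ) := ⟨by norm_num⟩
  exact etaMC_r1_of_eigenHom h22 h41 h6273 hGZK 5 (le_refl 5) _ hr V C
    (by rw [show ((-1 : ℚ) ^ ((5 : ℕ) / 2) * ((5 : ℕ) : ℚ)) = 5 by norm_num]; exact hC) hgood hap hns hX hP

/-- The `5`-partner of u5a:-71, `W = [1, -1, 0, -505320867, -4369691556084]` (non-CM, `N_W = 5502125475`; `j(W) = j(A)`, `A = [1,−1,1,−4010,98676]` the `t = 4/5` member of Zywina's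
`X_ns⁺(5)` family, twisted by `D = -71`): `Δ ≠ 0` (kernel). [cite: Zywina2015, Thm. 1.4] -/
theorem isElliptic_u5a_m71 : (⟨1, (-1), 0, (-505320867), (-4369691556084)⟩ : WeierstrassCurve ℚ).IsElliptic :=
  isElliptic_of_discOf_ne_zero 1 (-1) 0 (-505320867) (-4369691556084) (by decide +kernel)

/-- **(C1⁺_η) at `p = 5` for every good `a_5 = 0` model `V` of the `5`-twist of the UNCONGRUENT partner u5a:-71** (`W = [1, -1, 0, -505320867, -4369691556084]`, non-CM,
`N_W = 5502125475`; kit j326613 (5275 s, GRH): `ε(W) = −1`, PARI plus-`η` `(λ, μ) = (1, 0)`, `r_an(W) = 1` (`ellanalyticrank`); `h(ℚ(P)) = 38400` (`[60,10,2,2,2,2,2,2]`, `v₅ = 2 > 1`: door L6⁻ void), eigen dimensions `(0,0,1,1)`: `2` is not an eigenvalue of `σ₂` — the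
plain class-number door and door L6⁻ are void, door L2 passes) from the ROW ALONE — named facts `h22 h41 h6273 hGZK`; displayed `r_an(W) = 1`, the
tower clause, `(L_5⁺(V,η,X)) = (X)`, the plain eigen datum. A row of v7's `stub_etaMC_nonCM_uncongruent` (p666083). Instance of
`etaMC_r1_of_eigenHom` (p708181). CONDITIONAL; nothing booked. [cite: Kobayashi2003, §4 (p. 8)] [cite: CoatesSujatha2005, §3 Thm. 3.4] [cite: Zywina2015, Thm. 1.4] -/
theorem etaMC_r1_u5a_m71_5_of_eigenHom
    (h22 : Kobayashi2003.thm22_etaSignedSelmerDual_finite_torsion)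
    (h41 : Kobayashi2003.thm41_plusEtaCharIdeal_dvd)
    (h6273 : Kobayashi2003.thm62_63_73_etaColemanPoitouTate)
    (hGZK : rank_eq_analyticRank_of_analyticRank_le_one) [Fact (5 : ℕ).Prime]
    (W : WeierstrassCurve ℚ) (hW : W = (⟨1, (-1), 0, (-505320867), (-4369691556084)⟩ : WeierstrassCurve ℚ)) (hr : W.analyticRank = 1)
    (V : WeierstrassCurve ℚ) [V.IsElliptic] [V.IsGloballyMinimal] (C : VariableChange ℚ)
    (hC : C • W.quadraticTwist 5 = V)
    (hgood : V.HasGoodReductionAtPrime 5) (hap : V.frobeniusTrace 5 = 0)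
    (hns : ¬ ∀ m : ℕ, V.HasSurjectiveModNGaloisRep (5 ^ m : ℕ))
    (hX : ∀ {N : ℕ} [NeZero N] {f : CuspForm (Gamma0 N) 2}, IsNewformOf V f →
      ∀ (ϖ : ℚ), (if Even (5 / 2) then (ϖ : ℝ) * V.realPeriodRat = plusPeriod f
          else (ϖ : ℝ) * V.imaginaryPeriodRat = minusPeriod f) →
      ∀ (Lη : IwasawaAlgebra 5), IsQuadraticBranchPlusLFunction f 5 ϖ Lη →
        Ideal.span {Lη} = Ideal.span {(PowerSeries.X : IwasawaAlgebra 5)})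
    (hP : haveI : W.IsElliptic := hW ▸ isElliptic_u5a_m71
      haveI : NeZero (5 : ℕ) := ⟨by norm_num⟩
      haveI : NumberField (W.divisionField 5) := NumberField.mk
      ∃ P : geomTorsion W ((5 : ℕ) : ℤ), P ≠ 0 ∧
        ∀ K : IntermediateField ℚ (W.divisionField 5),
          K = IntermediateField.fixedField
            ((MulAction.stabilizer (absoluteGaloisGroup ℚ) P).map (absRestrictNormalHom (W.divisionField 5))) →
        ∀ μ : Additive (ClassGroup (𝓞 K)) →+ ZMod 5,
          (∀ (τ : absoluteGaloisGroup ℚ) (σ : K ≃ₐ[ℚ] K) (a : ℕ),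
              (∀ x : K, absRestrictNormalHom (W.divisionField 5) τ (x : W.divisionField 5) =
                ((σ x : K) : W.divisionField 5)) → τ • P = a • P →
              ∀ (I J : (Ideal (𝓞 K))⁰),
                (J : Ideal (𝓞 K)) = (I : Ideal (𝓞 K)).map (AmbiguousClass.intAut σ : 𝓞 K →+* 𝓞 K) →
                μ (Additive.ofMul (ClassGroup.mk0 J)) = a • μ (Additive.ofMul (ClassGroup.mk0 I))) →
          μ = 0) :
    QuadraticBranchPlusEtaMainConjectureAt V 5 := by
  subst hW
  haveI : (⟨1, (-1), 0, (-505320867), (-4369691556084)⟩ : WeierstrassCurve ℚ).IsElliptic := isElliptic_u5a_m71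
  haveI : NeZero (5 : ℕ) := ⟨by norm_num⟩
  exact etaMC_r1_of_eigenHom h22 h41 h6273 hGZK 5 (le_refl 5) _ hr V C
    (by rw [show ((-1 : ℚ) ^ ((5 : ℕ) / 2) * ((5 : ℕ) : ℚ)) = 5 by norm_num]; exact hC) hgood hap hns hX hP

end Summit.BirchSwinnertonDyer.BirchSwinnertonDyer.Theorems.EtaConjADoorUncongruentRecords

end
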